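import Summits.BirchSwinnertonDyer.Rank1Residual.X11b.BDPRouteCyclotomicLeverClass
import HarnessLib

/-!
# Class X11b (and any rank-one pair at a multiplicative prime): PER-PAIR CLOSURE from the one-sided
# cyclotomic lever — `p ∤ #Ш(E)_an` + ONE non-degenerate canonical `p`-adic height ⟹ `BSD(E,p)`,
# with NO Heegner index, NO (ram), NO anticyclotomic input (cell `b2b-bsdres`, sub-cell `multr1-p2`,
# gen 21)

HONEST FRAMING (verbatim, cell `b2b-bsdres`, run/shared/lean/b2b/bsd-rank1-residual/): the goal of
the cell is to DELETE the COMBINATION-SHAPED residual classes for ALL analytic-rank `≤ 1` curves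
over `ℚ` — "full BSD formula for every rank `≤ 1` curve in class `C`" assembled STRICTLY from
published theorems — so that the rank-`≤ 1` remainder becomes exactly the CONSTRUCTION-SHAPED
classes, which are TYPED (missing-input Props), NOT attempted; this is not "finishing BSD".
Research route `p2` for class X11b; no claim beyond the stated class and loci; nothing booked; X11b
stays CONSTRUCTION-SHAPED. THEOREMS ONLY (no definition, no named fact, no `sorry`). PER PAIR, not a
class theorem: every theorem consumes TWO per-pair inputs — the COMPUTED value `ord_p #Ш(E)_an ≤ 0`
(a classical BSD-quotient computation, the lane's `#Ш_an` column) and `Reg_p(E) ≠ 0` for THE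
canonical `p`-adic height (`ClassClosure.RegulatorNonvanishingAt W p` / `SchneiderConjecture Dh`;
class-wide = Schneider's conjecture, OPEN) — whether such certificates close a pair is the referee's
ruling (lane business); nothing is booked here.

## What this file does

The cell's `p`-adic certificate engine (`Typed/PAdicCertificateEngine.lean`, Miller 2011 Prop. 7.6;
instances `Typed.X11.bsdp_of_katoSurj_{split,nonsplit}_of_surjective_pow_of_certificate`) closes a
rank-`≤ 1` pair at a multiplicative `p` from Kato's divisibility + Jones's clause + a COMPUTED
`p`-adic valuation identity `ord_p(ϖ·[T^{r+e}]L·log^{r+e}·#T²) = ord_p(ε·∏c·Reg_p)` + `p ∤ #Ш_an`.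
With Disegni 2020 Thm. 1 in the tree, the computed `p`-adic identity is REPLACED by the theorem: the
one-sided lever (`X11b/BDPRouteCyclotomicLeverClass.lean`) gives `ord_p #Ш(E) ≤ ord_p #Ш(E)_an`
from `Reg_p ≠ 0` alone, and if `ord_p #Ш(E)_an ≤ 0` the two halves of `BSD(E,p)` follow
(`0 ≤ ord_p #Ш ≤ ord_p #Ш_an ≤ 0`). So, in analytic rank one at a multiplicative `p`:

* `bsdp_of_upper_of_padicValRat_shaAn_le` — bookkeeping: the Euler-system half in numeric form +
  `ord_p #Ш_an ≤ 0` ⟹ `BSD(E,p)` (GZK for rank and finiteness).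
* `bsdp_of_katoSurj_nonsplit_of_schneider_of_padicValRat_shaAn_le` — NON-SPLIT `p`, ANY odd `p`,
  `ρ̄_{E,p^n}` onto ∀ `n`: `BSD(E,p)` ⇐ Kato (Wuthrich Thm. 3) + SW 6.1 + SW §4.2 + Disegni Thm. 1 +
  GZK + modularity + `SchneiderConjecture` for THE datum + `ord_p #Ш_an ≤ 0`.
* `bsdp_of_katoSurj_split_of_schneider_of_padicValRat_shaAn_le` — SPLIT `p ≥ 5` + a second
  multiplicative prime.
* `bsdp_of_katoSurj_of_regulatorNonvanishing_of_padicValRat_shaAn_le` — both signs, `p ≥ 5`,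
  `Surj W p`, per-pair input in the lane's shape `ClassClosure.RegulatorNonvanishingAt W p`.
* `bsdp_of_classX11b_of_regulatorNonvanishing_of_padicValRat_shaAn_le` — the X11b-shaped form.
Reach (class-wide X11b shape `p ≥ 5`, `N < 5·10⁵`; data, not claims): every surjective pair that is
non-split at `p` or has a second multiplicative prime — (ram) 2 155 109 + ¬(ram) 57 086 = 2 212 195
of 2 267 348 pairs — is closable by the two per-pair certificates WITHOUT any Heegner-index or
anticyclotomic input whenever `p ∤ #Ш_an` (in-window CORE-open rows of the lane at `p ≥ 5`, `N < 2·10⁴`: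
Locus 49, (ram) ∧ `p ∣ ∏c` 83, ¬(ram) 11 — the lane's `#Ш_an` column decides `hv` per pair).
CONDITIONAL on the named facts and the two per-pair inputs; PER PAIR; nothing booked; labels
UNCHANGED.

References: [Wuthrich2014] Thm. 3, Cor. 19; [SteinWuthrich2013] Thm. 6.1, §4.2; [Disegni2020]
Thm. 1, (∗); [Miller2011LMS] Def. 1.1, Prop. 7.6; [Schneider1982PadicHeightI] §1.
-/

set_option autoImplicit false

noncomputable section

open scoped Classical MatrixGroups ModularForm

open CongruenceSubgroup WeierstrassCurve
open Literature.NumberTheory.EllipticCurves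
  Literature.NumberTheory.EllipticCurves.ModularForms
  Literature.NumberTheory.EllipticCurves.Rank1Residual
  Literature.NumberTheory.EllipticCurves.Rank1Residual.Typed
  Literature.NumberTheory.EllipticCurves.Wuthrich2014
  Literature.NumberTheory.EllipticCurves.SteinWuthrich2013
  Literature.NumberTheory.EllipticCurves.Disegni2020
  Literature.NumberTheory.EllipticCurves.Skinner2016

namespace Summit.BirchSwinnertonDyer.Rank1Residual.X11b

variable (W : WeierstrassCurve ℚ) [W.IsElliptic] [W.IsGloballyMinimal] (p : ℕ) [Fact p.Prime]

omit [W.IsGloballyMinimal] in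
/-- **Bookkeeping: the Euler-system half in numeric form + `ord_p #Ш(E)_an ≤ 0` ⟹ `BSD(E,p)`** in
analytic rank `≤ 1` (GZK): `0 ≤ ord_p #Ш(E) ≤ ord_p #Ш(E)_an ≤ 0` forces both to vanish.
[cite: Miller2011LMS, Def. 1.1] -/
theorem bsdp_of_upper_of_padicValRat_shaAn_le (hGZK : rank_eq_analyticRank_of_analyticRank_le_one)
    (hr : W.analyticRank ≤ 1) {s : ℚ} (hs : shaAn W = (s : ℂ))
    (hup : (padicValNat p W.shaOrder : ℤ) ≤ padicValRat p s) (hv : padicValRat p s ≤ 0) :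
    BSDp W p :=
  Typed.bsdp_of_missingPPartAt W p hGZK hr
    (Typed.missingPPartAt_of_lower_of_upper W p ⟨s, hs, by omega⟩ ⟨s, hs, hup⟩)

/-- **Per-pair closure, NON-SPLIT multiplicative `p`, ANY odd `p`.** For `E/ℚ` (globally minimal
`W`) with `ord_{s=1} L(E,s) = 1`, `p ≠ 2` non-split multiplicative, `ρ̄_{E,p^n}` onto for all `n`:
`BSD(E,p)` from Kato's divisibility (`hK`), Stein–Wuthrich Thm. 6.1 (`hJ`) and §4.2 (`hH`), Disegni
Thm. 1 (`hD`), GZK (`hGZK`), modularity (`hpar`), and TWO per-pair inputs: `SchneiderConjecture Dh`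
for THE §4.2 datum (`hSch`) and `ord_p #Ш(E)_an ≤ 0` for THE rational value (`hv`, any `s` with
`shaAn W = s`). NO (ram), NO Heegner index, NO anticyclotomic input. CONDITIONAL; per pair; nothing
booked. [cite: Wuthrich2014, Thm. 3 (p. 383)] [cite: SteinWuthrich2013, Thm. 6.1 (p. 20), §4.2]
[cite: Disegni2020, Thm. 1 (§1.2)] [cite: Miller2011LMS, Def. 1.1, Prop. 7.6] -/
theorem bsdp_of_katoSurj_nonsplit_of_schneider_of_padicValRat_shaAn_le
    (hK : kato_charIdeal_dvd_multiplicative_of_surjective) (hJ : thm61_nonsplitMultiplicative)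
    (hH : exists_isMultCanonical) (hD : thm1_padicBSD_rankOne_multiplicative)
    (hGZK : rank_eq_analyticRank_of_analyticRank_le_one)
    (hpar : nonempty_modularParametrizationData)
    (hp : p ≠ 2) (hmult : W.HasMultiplicativeReductionAtPrime p)
    (hns : ¬ W.HasSplitMultiplicativeReductionAtPrime p) (hr : W.analyticRank = 1)
    (hρ : ∀ n : ℕ, W.HasSurjectiveModNGaloisRep (p ^ n : ℕ))
    (hSch : ∀ (q : ℚ_[p]) (Dh : PAdicHeightData W p), q ≠ 0 → ‖q‖ < 1 → tateJ q = (W.j : ℚ_[p]) →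
      IsMultCanonical Dh q → SchneiderConjecture Dh)
    {s : ℚ} (hs : shaAn W = (s : ℂ)) (hv : padicValRat p s ≤ 0) : BSDp W p :=
  bsdp_of_upper_of_padicValRat_shaAn_le W p hGZK (by rw [hr]) hs
    (finite_sha_and_padicValNat_shaOrder_le_of_katoSurj_nonsplit_of_schneider W p hK hJ hH hD hGZK hpar
      hp hmult hns hr hρ hSch hs).2 hv

/-- **Per-pair closure, SPLIT multiplicative `p ≥ 5` with a second multiplicative prime** (Disegni's
(∗)). As `bsdp_of_katoSurj_nonsplit_of_schneider_of_padicValRat_shaAn_le`. CONDITIONAL; per pair;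
nothing booked. [cite: Wuthrich2014, Thm. 3 (p. 383)] [cite: SteinWuthrich2013, Thm. 6.1 (p. 20), §4.2]
[cite: Disegni2020, Thm. 1 (§1.2), hypothesis (∗)] [cite: Miller2011LMS, Def. 1.1, Prop. 7.6] -/
theorem bsdp_of_katoSurj_split_of_schneider_of_padicValRat_shaAn_le
    (hK : kato_charIdeal_dvd_multiplicative_of_surjective) (hJ : thm61_splitMultiplicative)
    (hH : exists_isSplitMultCanonical) (hD : thm1_padicBSD_rankOne_multiplicative)
    (hGZK : rank_eq_analyticRank_of_analyticRank_le_one)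
    (hpar : nonempty_modularParametrizationData)
    (hp5 : 5 ≤ p) (hmult : W.HasMultiplicativeReductionAtPrime p)
    (hsplit : W.HasSplitMultiplicativeReductionAtPrime p) (hr : W.analyticRank = 1)
    (hρ : ∀ n : ℕ, W.HasSurjectiveModNGaloisRep (p ^ n : ℕ))
    (hm : ∃ (m : ℕ) (_ : Fact m.Prime), m ≠ p ∧ W.HasMultiplicativeReductionAtPrime m)
    (hSch : ∀ (Dq : TateParameterData W p) (Dh : PAdicHeightData W p),
      IsSplitMultCanonical Dh Dq → SchneiderConjecture Dh)
    {s : ℚ} (hs : shaAn W = (s : ℂ)) (hv : padicValRat p s ≤ 0) : BSDp W p :=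
  bsdp_of_upper_of_padicValRat_shaAn_le W p hGZK (by rw [hr]) hs
    (finite_sha_and_padicValNat_shaOrder_le_of_katoSurj_split_of_schneider W p hK hJ hH hD hGZK hpar
      hp5 hmult hsplit hr hρ hm hSch hs).2 hv

/-- **Per-pair closure at a multiplicative `p ≥ 5`, both signs, `ρ̄_{E,p}` onto**, with the per-pair
regulator input in the class-closure lane's shape and Disegni's (∗) as `hstar`. The rational value of
`#Ш_an` is unique, so `hv` may be stated for any `s` with `shaAn W = s`. CONDITIONAL; per pair;
nothing booked. [cite: Wuthrich2014, Thm. 3, Cor. 19 proof (p. 399)] [cite: SteinWuthrich2013, Thm. 6.1, §4.2]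
[cite: Disegni2020, Thm. 1 (§1.2), (∗)] [cite: Miller2011LMS, Def. 1.1, Prop. 7.6] -/
theorem bsdp_of_katoSurj_of_regulatorNonvanishing_of_padicValRat_shaAn_le
    (hK : kato_charIdeal_dvd_multiplicative_of_surjective)
    (hJn : thm61_nonsplitMultiplicative) (hJs : thm61_splitMultiplicative)
    (hHn : exists_isMultCanonical) (hHs : exists_isSplitMultCanonical)
    (hD : thm1_padicBSD_rankOne_multiplicative)
    (hGZK : rank_eq_analyticRank_of_analyticRank_le_one)
    (hpar : nonempty_modularParametrizationData)
    (hp5 : 5 ≤ p) (hmult : W.HasMultiplicativeReductionAtPrime p) (hr : W.analyticRank = 1)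
    (hsurj : Surj W p)
    (hstar : W.HasSplitMultiplicativeReductionAtPrime p →
      ∃ (m : ℕ) (_ : Fact m.Prime), m ≠ p ∧ W.HasMultiplicativeReductionAtPrime m)
    (hReg : ClassClosure.RegulatorNonvanishingAt W p)
    {s : ℚ} (hs : shaAn W = (s : ℂ)) (hv : padicValRat p s ≤ 0) : BSDp W p := by
  have hρ := kato_charIdeal_dvd_multiplicative_of_surjective.surjective_pow_of_five_le W p hp5 hsurj
  by_cases hsplit : W.HasSplitMultiplicativeReductionAtPrime p
  · exact bsdp_of_katoSurj_split_of_schneider_of_padicValRat_shaAn_le W p hK hJs hHs hD hGZK hpar hp5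
      hmult hsplit hr hρ (hstar hsplit) hReg.2 hs hv
  · exact bsdp_of_katoSurj_nonsplit_of_schneider_of_padicValRat_shaAn_le W p hK hJn hHn hD hGZK hpar
      (by omega) hmult hsplit hr hρ hReg.1 hs hv

/-- **X11b-shaped per-pair closure** (`ClassX11b W p`, `p ≥ 5`, `Surj W p`): `BSD(E,p)` from the
lever's published facts and the two per-pair inputs `RegulatorNonvanishingAt W p`,
`ord_p #Ш(E)_an ≤ 0` (+ (∗) at a split `p`). On the ¬(ram) atom this is the FIRST certificate road
of the cell that needs no anticyclotomic input (the Heegner-index certificate there runs into the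
Tamagawa/Kolyvagin defect or the missing lower half). CONDITIONAL; per pair; nothing booked; X11b
stays CONSTRUCTION-SHAPED. [cite: Wuthrich2014, Thm. 3 (p. 383)] [cite: SteinWuthrich2013, Thm. 6.1, §4.2]
[cite: Disegni2020, Thm. 1 (§1.2), (∗)] [cite: Miller2011LMS, Def. 1.1, Prop. 7.6] -/
theorem bsdp_of_classX11b_of_regulatorNonvanishing_of_padicValRat_shaAn_le
    (hK : kato_charIdeal_dvd_multiplicative_of_surjective)
    (hJn : thm61_nonsplitMultiplicative) (hJs : thm61_splitMultiplicative)
    (hHn : exists_isMultCanonical) (hHs : exists_isSplitMultCanonical)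
    (hD : thm1_padicBSD_rankOne_multiplicative)
    (hGZK : rank_eq_analyticRank_of_analyticRank_le_one)
    (hpar : nonempty_modularParametrizationData)
    (hX : ClassX11b W p) (hp5 : 5 ≤ p) (hsurj : Surj W p)
    (hstar : W.HasSplitMultiplicativeReductionAtPrime p →
      ∃ (m : ℕ) (_ : Fact m.Prime), m ≠ p ∧ W.HasMultiplicativeReductionAtPrime m)
    (hReg : ClassClosure.RegulatorNonvanishingAt W p)
    {s : ℚ} (hs : shaAn W = (s : ℂ)) (hv : padicValRat p s ≤ 0) : BSDp W p :=
  bsdp_of_katoSurj_of_regulatorNonvanishing_of_padicValRat_shaAn_le W p hK hJn hJs hHn hHs hD hGZK hpar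
    hp5 hX.2.2.1 hX.1 hsurj hstar hReg hs hv

end Summit.BirchSwinnertonDyer.Rank1Residual.X11b

end
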